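import Summits.FinalStateConjecture.FinalStateConjecture.Theorems.BartnikGapSettlingBondiBartnikRigidityRouteMarchingDefs
import Literature.Geometry.Lorentzian.CauchyProblemMGHDExistence
import HarnessLib

/-!
# K2b-5 `stub_marchingLemma`, brick 1: the INDUCTION SKELETON of the marching — line
# `direct-method-on-the-cone` (crux `BondiBartnikRigidity`, stmt-FinalStateConjecture-10807)

The marching lemma `K2Route.MarchingLemma` (report K2b-a2 §4) is an induction on the level `τ` of the
Kerr-star time `t*`: an exact chart of the collar background on the pull-back of
`Q_τ = (J⁺_K(slab)° ∩ {t* < τ}) ∪ F` (`F` a FIXED open one-sided collar of the lower boundary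
`slab ∪ roof`, charted by the boundary-collar chart `Ψ_E`) is pushed from level `τ` to level `τ + h`
with a step `h > 0` depending only on the target time `T₀`.  This file proves the part of that
argument which is pure logic and set bookkeeping:

* `marching_iterate` — the abstract iteration: `I τ₀`, `0 < h` and `∀ τ ≤ T₀, I τ → I (τ + h)` give
  `I τ` for some `τ > T₀` (Archimedes and `ℕ`-induction);
* `marchingLemma_of_exhaustion` — `MarchingLemma` follows once, for every `T₀`, SOME level `τ > T₀`
  carries an exact chart on the pull-back of `J⁺_K(slab)° ∩ {t* < τ}` (restriction,
  `K2Route.exactOn_pullK_mono`);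
* `marchingLemma_of_step` — **the typed reduction of the stub to the marching step**: with the
  concrete invariant `Inv τ` (an exact, time-orientation preserving open embedding `Ψ` of
  `pullK Q_τ` into `J⁺(C)` agreeing with the boundary-collar chart `Ψ_E` on
  `pullK (F ∪ slab ∪ (O ∩ roofK))`), the five inputs of the registered stub and the hypotheses of
  `MarchingLemma` need only produce, for every `T₀`, march data `(ρ, O, F, Ψ_E, h, τ₀)` with
  `0 < h`, `Inv τ₀` and `∀ τ ≤ T₀, Inv τ → Inv (τ + h)`;
* `pullK_slabK_eq_truncTimeSlab` — the seam check of the brief: for the collar background the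
  pull-back of the Kerr-side slab IS the thick collar slab `(B 0).truncTimeSlab (3M) 0`, so that
  `Φ₀ '' pullK slab ⊆ collarCore` (the form `K2Route.ExactChartPastSet` consumes).

References: Hawking–Ellis 1973, §7.6 [HawkingEllis1973CUP]; Choquet-Bruhat–Geroch 1969, Thm. 3
[ChoquetBruhatGeroch1969CMP].  No definitions, no named facts; nothing here is deep.
-/

noncomputable section

-- D-0017: single-problem summit, `Summit.<S>.<S>.…` by design (cf. lakefile `weak.linter.dupNamespace`).
set_option linter.dupNamespace false
-- instance search through the nested operator types of the Kerr chart facts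
set_option maxSynthPendingDepth 3

open Set Filter Function Topology TopologicalSpace
open Literature.Geometry.Lorentzian
open scoped Manifold ContDiff Topology ENNReal

namespace Summit.FinalStateConjecture.FinalStateConjecture.Theorems.BondiBartnikRigidity.DirectMethod

namespace Marching

open K2Route

/-! ### The seam `pullK slab = truncTimeSlab (3M) 0` for the collar background -/

/-- **Seam check**: for the collar background `B = starBackground Λ c M a (r_a ∘ (Λ,c)⁻¹)` the
pull-back of the Kerr-side thick slab `slabK = {t* = 0, r ≤ 3M}` is the background's truncated time
slab `{t = 0, r ≤ 3M}` (both coordinates of `B` are the rest-frame Kerr-star ones). [folklore] -/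
theorem pullK_slabK_eq_truncTimeSlab {mo : lorentzGroup × E4} {M a : ℝ} {B : ModelBackground}
    (hB : B = starBackground mo.1 mo.2 M a (fun x => Kerr.radius a (poincareInv mo.1 mo.2 x))) :
    pullK mo M a B (slabK M a) = B.truncTimeSlab (3 * M) 0 := by
  subst hB
  ext x
  exact ⟨fun ⟨_, h⟩ => h, fun h => ⟨x.2, h⟩⟩

/-- The image of the pulled-back slab under the collar chart lies in the collar core
`C = {p} ∪ Φ₀(truncTimeSlab (3M) 0)` (the hypothesis `Φ₀ '' pullK slab ⊆ C` of
`K2Route.ExactChartPastSet`). [folklore] -/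
theorem image_pullK_slabK_subset_collarCore {α : Type} (M a : Fin 1 → ℝ) (p : α)
    (mo : Fin 1 → lorentzGroup × E4) (B : Fin 1 → ModelBackground) (Φ : ∀ i, (B i).domain → α)
    (hB : ∀ i, B i = starBackground (mo i).1 (mo i).2 (M i) (a i)
      (fun x => Kerr.radius (a i) (poincareInv (mo i).1 (mo i).2 x))) :
    Φ 0 '' pullK (mo 0) (M 0) (a 0) (B 0) (slabK (M 0) (a 0)) ⊆ collarCore M p B Φ := by
  rw [pullK_slabK_eq_truncTimeSlab (hB 0)]
  exact image_truncTimeSlab_subset_collarCore M p B Φ 0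

/-! ### The abstract iteration -/

/-- **The marching iteration** (pure logic): if `I τ₀` holds, `0 < h`, and `I` is pushed from every
level `τ ≤ T₀` to `τ + h`, then `I τ` holds at some level `τ > T₀` (after `⌈(T₀ − τ₀)/h⌉ + 1` steps;
Archimedes). [folklore] -/
theorem marching_iterate {I : ℝ → Prop} {T₀ h τ₀ : ℝ} (hh : 0 < h) (h0 : I τ₀)
    (hstep : ∀ τ, τ ≤ T₀ → I τ → I (τ + h)) : ∃ τ, T₀ < τ ∧ I τ := by
  -- either some level `> T₀` is already reached, or the `n`-th iterate holds
  have key : ∀ n : ℕ, (∃ τ, T₀ < τ ∧ I τ) ∨ I (τ₀ + n * h) := by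
    intro n
    induction n with
    | zero => exact Or.inr (by simpa using h0)
    | succ n ih =>
      rcases ih with h' | h'
      · exact Or.inl h'
      · by_cases hle : τ₀ + n * h ≤ T₀
        · refine Or.inr ?_
          have := hstep _ hle h'
          simpa [Nat.cast_succ, add_mul, one_mul, add_assoc] using this
        · exact Or.inl ⟨_, lt_of_not_ge hle, h'⟩
  obtain ⟨n, hn⟩ := exists_nat_gt ((T₀ - τ₀) / h)
  rcases key n with h' | h'
  · exact h'
  · refine ⟨_, ?_, h'⟩
    have : T₀ - τ₀ < n * h := by rwa [div_lt_iff₀ hh] at hn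
    linarith

/-! ### `MarchingLemma` from exhaustion by exact charts -/

variable {X : Type} [TopologicalSpace X] [ChartedSpace E3 X] [IsManifold (𝓡 3) ∞ X]
  [ConnectedSpace X] {D : InitialDataSet (𝓡 3) X}

/-- **Restriction step**: an exact chart on the pull-back of `J⁺_K(slab)° ∩ {t* < τ}` restricts to one
on the pull-back of `J⁺_K(slab)° ∩ {t* < T₀}` for `T₀ ≤ τ` (`exactOn_pullK_mono`, the target set being
open, `isOpen_interior_JK_inter_lt`). [folklore] -/
theorem exactOn_slab_future_mono [Kerr.Facts] {𝒮 : Spacetime.{0} 4} {mo : lorentzGroup × E4} {M a : ℝ}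
    (hM : 0 < M) {B : ModelBackground}
    (hB : B = starBackground mo.1 mo.2 M a (fun x => Kerr.radius a (poincareInv mo.1 mo.2 x)))
    {J : Set 𝒮.carrier} {Ψ : B.domain → 𝒮.carrier} {τ T₀ : ℝ} (hT : T₀ ≤ τ)
    (hs : ContMDiffOn 𝓘(ℝ, E4) (𝓡 4) ∞ Ψ
      (pullK mo M a B (interior (JK M a hM (slabK M a)) ∩ {y | y.1 0 < τ})))
    (he : IsOpenEmbedding ((pullK mo M a B (interior (JK M a hM (slabK M a)) ∩ {y | y.1 0 < τ})).restrict Ψ))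
    (hJ : Ψ '' pullK mo M a B (interior (JK M a hM (slabK M a)) ∩ {y | y.1 0 < τ}) ⊆ J)
    (hd : supCkENorm (Subtype.val '' pullK mo M a B (interior (JK M a hM (slabK M a)) ∩ {y | y.1 0 < τ})) 0
      (𝒮.deviationExtend B Ψ) ≤ 0) :
    ContMDiffOn 𝓘(ℝ, E4) (𝓡 4) ∞ Ψ
        (pullK mo M a B (interior (JK M a hM (slabK M a)) ∩ {y | y.1 0 < T₀})) ∧
      IsOpenEmbedding ((pullK mo M a B (interior (JK M a hM (slabK M a)) ∩ {y | y.1 0 < T₀})).restrict Ψ) ∧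
      Ψ '' pullK mo M a B (interior (JK M a hM (slabK M a)) ∩ {y | y.1 0 < T₀}) ⊆ J ∧
      supCkENorm (Subtype.val '' pullK mo M a B (interior (JK M a hM (slabK M a)) ∩ {y | y.1 0 < T₀})) 0
        (𝒮.deviationExtend B Ψ) ≤ 0 :=
  exactOn_pullK_mono hB hs he hJ hd (fun _ hy => ⟨hy.1, lt_of_lt_of_le hy.2 hT⟩)
    (isOpen_interior_JK_inter_lt M a hM T₀)

/-- **`MarchingLemma` by exhaustion**: it suffices that, under the hypotheses of `MarchingLemma`, for
every `T₀` SOME level `τ > T₀` carries an exact chart (smooth open embedding, image in `J⁺(C)`,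
deviation `0`) on the pull-back of `J⁺_K(slab)° ∩ {t* < τ}`. [folklore] -/
theorem marchingLemma_of_exhaustion
    (H : ∀ [Kerr.Facts] (k' : ℕ), 1 ≤ k' →
      ∀ (X : Type) [TopologicalSpace X] [ChartedSpace E3 X] [IsManifold (𝓡 3) ∞ X]
        [T2Space X] [SecondCountableTopology X] [ConnectedSpace X]
        (D : InitialDataSet (𝓡 3) X) (𝒱 : VacuumCauchyDevelopment D)
        (M a : Fin 1 → ℝ) (p : 𝒱.carrier) (mo : Fin 1 → lorentzGroup × E4)
        (B : Fin 1 → ModelBackground) (Φ : ∀ i, (B i).domain → 𝒱.carrier)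
        (hmax : 𝒱.IsMaximal) (hpar : ∀ i, 0 < M i ∧ |a i| < M i),
      (∃ i, p ∈ Φ i '' (B i).truncTimeSlab (3 * M i) 0) →
      (∀ i, B i = starBackground (mo i).1 (mo i).2 (M i) (a i)
        (fun x => Kerr.radius (a i) (poincareInv (mo i).1 (mo i).2 x))) →
      (∀ i, ContMDiffOn 𝓘(ℝ, E4) (𝓡 4) ∞ (Φ i)
          {x | -1 < (B i).time x.1 ∧ (B i).time x.1 < 1 ∧ (B i).radius x.1 < 3 * M i + 1} ∧
        IsOpenEmbedding ({x | -1 < (B i).time x.1 ∧ (B i).time x.1 < 1 ∧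
          (B i).radius x.1 < 3 * M i + 1}.restrict (Φ i))) →
      (∀ i, 𝒱.toSpacetime.truncDeviationCk (B i) (Φ i) k' (3 * M i) 0 ≤ 0) →
      CollarFutureOriented 𝒱 M mo B Φ →
      collarCore M p B Φ ⊆ range 𝒱.embed →
      (∀ ρ : ℝ, ∃ (O : Set (Kerr.region (a 0) (M 0))) (Ψ : (B 0).domain → 𝒱.carrier),
        IsBoundaryCollarChart (mo 0) (M 0) (a 0) (hpar 0).1 (B 0) (collarCore M p B Φ)
          (𝒱.metric.causalFuture 𝒱.timeOrientation (collarCore M p B Φ)) (Φ 0) ρ O Ψ) →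
      ∀ T₀ : ℝ, ∃ τ : ℝ, T₀ < τ ∧ ∃ Ψ : (B 0).domain → 𝒱.carrier,
        ContMDiffOn 𝓘(ℝ, E4) (𝓡 4) ∞ Ψ
          (pullK (mo 0) (M 0) (a 0) (B 0) (interior (JK (M 0) (a 0) (hpar 0).1 (slabK (M 0) (a 0))) ∩ {y | y.1 0 < τ})) ∧
        IsOpenEmbedding ((pullK (mo 0) (M 0) (a 0) (B 0)
          (interior (JK (M 0) (a 0) (hpar 0).1 (slabK (M 0) (a 0))) ∩ {y | y.1 0 < τ})).restrict Ψ) ∧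
        Ψ '' pullK (mo 0) (M 0) (a 0) (B 0) (interior (JK (M 0) (a 0) (hpar 0).1 (slabK (M 0) (a 0))) ∩ {y | y.1 0 < τ}) ⊆
          𝒱.metric.causalFuture 𝒱.timeOrientation (collarCore M p B Φ) ∧
        supCkENorm (Subtype.val '' pullK (mo 0) (M 0) (a 0) (B 0)
          (interior (JK (M 0) (a 0) (hpar 0).1 (slabK (M 0) (a 0))) ∩ {y | y.1 0 < τ})) 0
          (𝒱.toSpacetime.deviationExtend (B 0) Ψ) ≤ 0) :
    MarchingLemma := by
  intro _ k' hk' X _ _ _ _ _ _ D 𝒱 M a p mo B Φ hmax hpar hp hB hΦ hdev hor hCX hcoll T₀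
  obtain ⟨τ, hτ, Ψ, hs, he, hJ, hd⟩ :=
    H k' hk' X D 𝒱 M a p mo B Φ hmax hpar hp hB hΦ hdev hor hCX hcoll T₀
  exact ⟨Ψ, exactOn_slab_future_mono (hpar 0).1 (hB 0) hτ.le hs he hJ hd⟩

/-! ### The typed reduction of the stub to the marching step -/

/-- **`stub_marchingLemma` ⟸ the marching step (typed reduction).**  Fix the data of
`MarchingLemma` (one exact, future-oriented thick Kerr collar chart `Φ 0` of the collar background
`B 0` in the maximal vacuum development `𝒱`, core `C` on the Cauchy slice, boundary-collar charts for
every radius) and write `W = J⁺_K(slab)°`, `V = −g♯dt*` (`Kerr.timeVector`).  The INVARIANT at level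
`τ` for march data `(O, F, Ψ_E)` is: some `Ψ` is smooth on `pullK Q_τ`,
`Q_τ = (W ∩ {t* < τ}) ∪ F`, an open embedding of it into `J⁺(C)` with deviation `0`, pushes `ΛV` to
a future-directed vector there, and equals `Ψ_E` on `pullK (F ∪ slab ∪ (O ∩ roofK))`.  If the five
inputs of the stub and the hypotheses of `MarchingLemma` yield, for every `T₀`, march data and
`h > 0`, `τ₀` with the invariant at `τ₀` and the STEP `∀ τ ≤ T₀, Inv τ → Inv (τ + h)`, then the
registered signature of `stub_marchingLemma` holds (`marching_iterate`, then restriction of the chart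
from `Q_τ` to its open subset `W ∩ {t* < T₀}`).  [folklore] -/
theorem marchingLemma_of_step
    (hstep : SlabFutureContainsCylinder → SlabFrontier → ExactChartPastSet → ExactChartGluing →
      choquetBruhat_geroch_exists_mghd_cauchy →
      ∀ [Kerr.Facts] (k' : ℕ), 1 ≤ k' →
      ∀ (X : Type) [TopologicalSpace X] [ChartedSpace E3 X] [IsManifold (𝓡 3) ∞ X]
        [T2Space X] [SecondCountableTopology X] [ConnectedSpace X]
        (D : InitialDataSet (𝓡 3) X) (𝒱 : VacuumCauchyDevelopment D)
        (M a : Fin 1 → ℝ) (p : 𝒱.carrier) (mo : Fin 1 → lorentzGroup × E4)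
        (B : Fin 1 → ModelBackground) (Φ : ∀ i, (B i).domain → 𝒱.carrier)
        (hmax : 𝒱.IsMaximal) (hpar : ∀ i, 0 < M i ∧ |a i| < M i),
      (∃ i, p ∈ Φ i '' (B i).truncTimeSlab (3 * M i) 0) →
      (∀ i, B i = starBackground (mo i).1 (mo i).2 (M i) (a i)
        (fun x => Kerr.radius (a i) (poincareInv (mo i).1 (mo i).2 x))) →
      (∀ i, ContMDiffOn 𝓘(ℝ, E4) (𝓡 4) ∞ (Φ i)
          {x | -1 < (B i).time x.1 ∧ (B i).time x.1 < 1 ∧ (B i).radius x.1 < 3 * M i + 1} ∧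
        IsOpenEmbedding ({x | -1 < (B i).time x.1 ∧ (B i).time x.1 < 1 ∧
          (B i).radius x.1 < 3 * M i + 1}.restrict (Φ i))) →
      (∀ i, 𝒱.toSpacetime.truncDeviationCk (B i) (Φ i) k' (3 * M i) 0 ≤ 0) →
      CollarFutureOriented 𝒱 M mo B Φ →
      collarCore M p B Φ ⊆ range 𝒱.embed →
      (∀ ρ : ℝ, ∃ (O : Set (Kerr.region (a 0) (M 0))) (Ψ : (B 0).domain → 𝒱.carrier),
        IsBoundaryCollarChart (mo 0) (M 0) (a 0) (hpar 0).1 (B 0) (collarCore M p B Φ)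
          (𝒱.metric.causalFuture 𝒱.timeOrientation (collarCore M p B Φ)) (Φ 0) ρ O Ψ) →
      ∀ T₀ : ℝ, ∃ (O F : Set (Kerr.region (a 0) (M 0))) (ΨE : (B 0).domain → 𝒱.carrier) (h τ₀ : ℝ),
        0 < h ∧
        let Inv : ℝ → Prop := fun τ => ∃ Ψ : (B 0).domain → 𝒱.carrier,
          ContMDiffOn 𝓘(ℝ, E4) (𝓡 4) ∞ Ψ (pullK (mo 0) (M 0) (a 0) (B 0)
            (interior (JK (M 0) (a 0) (hpar 0).1 (slabK (M 0) (a 0))) ∩ {y | y.1 0 < τ} ∪ F)) ∧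
          IsOpenEmbedding ((pullK (mo 0) (M 0) (a 0) (B 0)
            (interior (JK (M 0) (a 0) (hpar 0).1 (slabK (M 0) (a 0))) ∩ {y | y.1 0 < τ} ∪ F)).restrict Ψ) ∧
          Ψ '' pullK (mo 0) (M 0) (a 0) (B 0)
              (interior (JK (M 0) (a 0) (hpar 0).1 (slabK (M 0) (a 0))) ∩ {y | y.1 0 < τ} ∪ F) ⊆
            𝒱.metric.causalFuture 𝒱.timeOrientation (collarCore M p B Φ) ∧
          supCkENorm (Subtype.val '' pullK (mo 0) (M 0) (a 0) (B 0)
            (interior (JK (M 0) (a 0) (hpar 0).1 (slabK (M 0) (a 0))) ∩ {y | y.1 0 < τ} ∪ F)) 0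
            (𝒱.toSpacetime.deviationExtend (B 0) Ψ) ≤ 0 ∧
          (∀ x ∈ pullK (mo 0) (M 0) (a 0) (B 0)
              (interior (JK (M 0) (a 0) (hpar 0).1 (slabK (M 0) (a 0))) ∩ {y | y.1 0 < τ} ∪ F),
            𝒱.timeOrientation.IsFutureDirected (mfderiv 𝓘(ℝ, E4) (𝓡 4) Ψ x
              (((mo 0).1 : E4 ≃L[ℝ] E4) (Kerr.timeVector (M 0) (a 0) (poincareInv (mo 0).1 (mo 0).2 x.1))))) ∧
          (∀ x ∈ pullK (mo 0) (M 0) (a 0) (B 0)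
              (F ∪ slabK (M 0) (a 0) ∪ (O ∩ roofK (M 0) (a 0) (hpar 0).1)), Ψ x = ΨE x)
        Inv τ₀ ∧ ∀ τ, τ ≤ T₀ → Inv τ → Inv (τ + h)) :
    SlabFutureContainsCylinder → SlabFrontier → ExactChartPastSet → ExactChartGluing →
      choquetBruhat_geroch_exists_mghd_cauchy → MarchingLemma := by
  intro h1 h2 h3 h4 h5
  refine marchingLemma_of_exhaustion ?_
  intro _ k' hk' X _ _ _ _ _ _ D 𝒱 M a p mo B Φ hmax hpar hp hB hΦ hdev hor hCX hcoll T₀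
  obtain ⟨O, F, ΨE, h, τ₀, hh, h0, hst⟩ :=
    hstep h1 h2 h3 h4 h5 k' hk' X D 𝒱 M a p mo B Φ hmax hpar hp hB hΦ hdev hor hCX hcoll T₀
  obtain ⟨τ, hτ, Ψ, hs, he, hJ, hd, -, -⟩ := marching_iterate hh h0 hst
  refine ⟨τ, hτ, Ψ, ?_⟩
  exact exactOn_pullK_mono (hB 0) hs he hJ hd subset_union_left
    (isOpen_interior_JK_inter_lt (M 0) (a 0) (hpar 0).1 τ)

end Marching

/-- **Registered brick `stub_marchingLemma_of_step` of the line** (K2b-5, induction skeleton of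
`stub_marchingLemma`): the abstract marching iteration — `I τ₀`, `0 < h` and
`∀ τ ≤ T₀, I τ → I (τ + h)` give `I τ` at some level `τ > T₀` (anchor of this file; the typed
reduction of the stub to the concrete marching step is `Marching.marchingLemma_of_step`, and
`MarchingLemma` from exhaustion by exact charts is `Marching.marchingLemma_of_exhaustion`).
[folklore] -/
theorem stub_marchingLemma_of_step : ∀ (I : ℝ → Prop) (T₀ h τ₀ : ℝ), 0 < h → I τ₀ →
    (∀ τ, τ ≤ T₀ → I τ → I (τ + h)) → ∃ τ, T₀ < τ ∧ I τ :=
  fun _ _ _ _ hh h0 hstep => Marching.marching_iterate hh h0 hstep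

end Summit.FinalStateConjecture.FinalStateConjecture.Theorems.BondiBartnikRigidity.DirectMethod

end
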